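import Mathlib.Data.ZMod.Basic
import Mathlib.FieldTheory.Finite.Basic
import HarnessLib

/-!
# Route `ResidualThetaTransportAtTwo`, node 27436 (cruxes Kan⁺ stmt-BirchSwinnertonDyer-20688 / Kμ⁺ 20689 / 21437), composite levels:
# the CRT AVOIDANCE LEMMA — an integer avoiding fewer than `ℓ` prescribed residue classes modulo each prime `ℓ` of a finite set

Cell `bsd-wall`, width seat `bsd-wall-rtt-p3-w2` g4 (2026-08-28). THEOREMS ONLY (pure arithmetic); `--supports stmt-BirchSwinnertonDyer-20688`;
BSD is not proved by this. Requested split of width seat w4 g2's all-odd-rows induction (`Lines/birth-rows-allodd.md` §3(iii), §4 (C1)):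
«choose `D` (CRT, per prime `ℓ ∣ N`) avoiding ≤ 3 residue classes mod `ℓ`».

* `exists_int_forall_prime_not_dvd_sub` — for a finite set `S` of primes and, for each `ℓ ∈ S`, a finite set `bad ℓ` of integers with
  `(bad ℓ).card < ℓ`: an integer `D` with `ℓ ∤ D − r` for every `ℓ ∈ S`, `r ∈ bad ℓ`.
* `exists_int_modEq_forall_prime_not_dvd_sub` — the same with an extra congruence `D ≡ a (mod M)` for `M` prime to every `ℓ ∈ S`.
* `exists_nat_forall_prime_not_dvd_sub` — a positive natural-number version.

References: Sun Zi / C. F. Gauss, *Disquisitiones* §32 (Chinese remainder theorem) — Mathlib `Int.emod_emod_of_dvd`, `ZMod`.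
-/

set_option autoImplicit false
set_option linter.dupNamespace false

namespace Summit.BirchSwinnertonDyer.BirchSwinnertonDyer.Theorems.SignedMuAtTwo

/-- In `ZMod ℓ` (`ℓ` prime) a finite set of fewer than `ℓ` integers misses some class. [folklore] -/
theorem exists_zmod_forall_ne {ℓ : ℕ} [Fact ℓ.Prime] (bad : Finset ℤ) (hcard : bad.card < ℓ) :
    ∃ c : ZMod ℓ, ∀ r ∈ bad, (r : ZMod ℓ) ≠ c := by
  classical
  by_contra h
  push Not at h
  have hsub : (Finset.univ : Finset (ZMod ℓ)) ⊆ bad.image (fun r : ℤ ↦ (r : ZMod ℓ)) := by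
    intro c _
    obtain ⟨r, hr, hrc⟩ := h c
    exact Finset.mem_image.mpr ⟨r, hr, hrc⟩
  have h1 := Finset.card_le_card hsub
  rw [Finset.card_univ, ZMod.card] at h1
  have h2 := Finset.card_image_le (s := bad) (f := fun r : ℤ ↦ (r : ZMod ℓ))
  omega

/-- **CRT avoidance with a congruence.** `S` a finite set of primes, `bad ℓ` a set of fewer than `ℓ` integers for each `ℓ ∈ S`,
`M` an integer prime to every `ℓ ∈ S`, `a` any integer: there is `D ≡ a (mod M)` with `ℓ ∤ D − r` for all `ℓ ∈ S`, `r ∈ bad ℓ`.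
[folklore] -/
theorem exists_int_modEq_forall_prime_not_dvd_sub (S : Finset ℕ) (hS : ∀ ℓ ∈ S, ℓ.Prime) (bad : ℕ → Finset ℤ)
    (hcard : ∀ ℓ ∈ S, (bad ℓ).card < ℓ) (M : ℤ) (hM : ∀ ℓ ∈ S, ¬ (ℓ : ℤ) ∣ M) (a : ℤ) :
    ∃ D : ℤ, (M ∣ D - a) ∧ ∀ ℓ ∈ S, ∀ r ∈ bad ℓ, ¬ (ℓ : ℤ) ∣ D - r := by
  classical
  induction S using Finset.induction_on with
  | empty => exact ⟨a, by simp, by simp⟩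
  | @insert ℓ S hℓS ih =>
    have hℓ : ℓ.Prime := hS ℓ (Finset.mem_insert_self _ _)
    haveI : Fact ℓ.Prime := ⟨hℓ⟩
    obtain ⟨D₀, hD₀M, hD₀⟩ := ih (fun ℓ' h ↦ hS ℓ' (Finset.mem_insert_of_mem h)) (fun ℓ' h ↦ hcard ℓ' (Finset.mem_insert_of_mem h))
      (fun ℓ' h ↦ hM ℓ' (Finset.mem_insert_of_mem h))
    -- the step modulus `P := M · ∏_{ℓ' ∈ S} ℓ'` is prime to `ℓ`
    set P : ℤ := M * ∏ ℓ' ∈ S, (ℓ' : ℤ) with hP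
    have hPℓ : (P : ZMod ℓ) ≠ 0 := by
      intro h0
      have hdvd : (ℓ : ℤ) ∣ P := (ZMod.intCast_zmod_eq_zero_iff_dvd P ℓ).mp h0
      have hprime : Prime (ℓ : ℤ) := Nat.prime_iff_prime_int.mp hℓ
      rcases hprime.dvd_or_dvd hdvd with h1 | h1
      · exact hM ℓ (Finset.mem_insert_self _ _) h1
      · obtain ⟨ℓ', hℓ'S, hℓℓ'⟩ := (Prime.dvd_finsetProd_iff hprime _).mp h1
        have hℓ'p : ℓ'.Prime := hS ℓ' (Finset.mem_insert_of_mem hℓ'S)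
        have : ℓ ∣ ℓ' := Int.natCast_dvd_natCast.mp hℓℓ'
        have := (Nat.prime_dvd_prime_iff_eq hℓ hℓ'p).mp this
        exact hℓS (this ▸ hℓ'S)
    -- choose the class mod `ℓ`
    obtain ⟨c, hc⟩ := exists_zmod_forall_ne (bad ℓ) (hcard ℓ (Finset.mem_insert_self _ _))
    set x : ℤ := ((((c - (D₀ : ZMod ℓ)) * (P : ZMod ℓ)⁻¹ : ZMod ℓ)).val : ℤ) with hx
    refine ⟨D₀ + P * x, ?_, ?_⟩
    · have : D₀ + P * x - a = (D₀ - a) + M * ((∏ ℓ' ∈ S, (ℓ' : ℤ)) * x) := by rw [hP]; ring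
      rw [this]; exact dvd_add hD₀M (dvd_mul_right _ _)
    · intro ℓ' hℓ' r hr
      rcases Finset.mem_insert.mp hℓ' with h | h
      · subst h
        intro hdvd
        have h0 : (((D₀ + P * x - r : ℤ)) : ZMod ℓ') = 0 := (ZMod.intCast_zmod_eq_zero_iff_dvd _ _).mpr hdvd
        push_cast at h0
        have hxc : ((x : ℤ) : ZMod ℓ') = (c - (D₀ : ZMod ℓ')) * (P : ZMod ℓ')⁻¹ := by
          rw [hx, Int.cast_natCast, ZMod.natCast_zmod_val]
        rw [hxc] at h0
        apply hc r hr
        have : (r : ZMod ℓ') = (D₀ : ZMod ℓ') + (P : ZMod ℓ') * ((c - (D₀ : ZMod ℓ')) * (P : ZMod ℓ')⁻¹) := by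
          linear_combination -h0
        rw [this, mul_comm ((c : ZMod ℓ') - _), ← mul_assoc, mul_inv_cancel₀ hPℓ, one_mul]
        ring
      · intro hdvd
        have hℓ'P : (ℓ' : ℤ) ∣ P := by
          rw [hP]; exact Dvd.dvd.mul_left (Finset.dvd_prod_of_mem _ h) _
        have : (ℓ' : ℤ) ∣ D₀ - r := by
          have e : D₀ - r = (D₀ + P * x - r) - P * x := by ring
          rw [e]; exact dvd_sub hdvd (Dvd.dvd.mul_right hℓ'P _)
        exact hD₀ ℓ' h r hr this

/-- **CRT avoidance.** `S` a finite set of primes and, for each `ℓ ∈ S`, fewer than `ℓ` forbidden integers: some integer `D` has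
`ℓ ∤ D − r` for every `ℓ ∈ S` and forbidden `r`. [folklore] -/
theorem exists_int_forall_prime_not_dvd_sub (S : Finset ℕ) (hS : ∀ ℓ ∈ S, ℓ.Prime) (bad : ℕ → Finset ℤ)
    (hcard : ∀ ℓ ∈ S, (bad ℓ).card < ℓ) : ∃ D : ℤ, ∀ ℓ ∈ S, ∀ r ∈ bad ℓ, ¬ (ℓ : ℤ) ∣ D - r := by
  obtain ⟨D, -, hD⟩ := exists_int_modEq_forall_prime_not_dvd_sub S hS bad hcard 1 (fun ℓ hℓ h ↦ by
    have := Int.eq_one_of_dvd_one (by positivity) h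
    have := (hS ℓ hℓ).one_lt; omega) 0
  exact ⟨D, hD⟩

/-- **CRT avoidance, positive natural number with a congruence.** As above with `D : ℕ`, `0 < D`, `D ≡ a (mod M)` for a modulus
`M : ℕ` prime to every `ℓ ∈ S`. [folklore] -/
theorem exists_nat_forall_prime_not_dvd_sub (S : Finset ℕ) (hS : ∀ ℓ ∈ S, ℓ.Prime) (bad : ℕ → Finset ℤ)
    (hcard : ∀ ℓ ∈ S, (bad ℓ).card < ℓ) (M : ℕ) (hM0 : 0 < M) (hM : ∀ ℓ ∈ S, ¬ ℓ ∣ M) (a : ℕ) :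
    ∃ D : ℕ, 0 < D ∧ D ≡ a [MOD M] ∧ ∀ ℓ ∈ S, ∀ r ∈ bad ℓ, ¬ (ℓ : ℤ) ∣ (D : ℤ) - r := by
  obtain ⟨D, hDM, hD⟩ := exists_int_modEq_forall_prime_not_dvd_sub S hS bad hcard (M : ℤ)
    (fun ℓ hℓ h ↦ hM ℓ hℓ (Int.natCast_dvd_natCast.mp h)) (a : ℤ)
  -- shift by a positive multiple of `M · ∏ ℓ` to make it positive
  set Q : ℤ := (M : ℤ) * ∏ ℓ ∈ S, (ℓ : ℤ) with hQ
  have hQpos : 0 < Q := by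
    rw [hQ]; apply mul_pos (by exact_mod_cast hM0)
    exact Finset.prod_pos fun ℓ hℓ ↦ by exact_mod_cast (hS ℓ hℓ).pos
  set D' : ℤ := D + Q * (|D| + 1) with hD'
  have hD'pos : 0 < D' := by
    rw [hD']
    have : |D| + 1 ≤ Q * (|D| + 1) := le_mul_of_one_le_left (by positivity) (by omega)
    have := neg_abs_le D
    omega
  refine ⟨D'.toNat, by omega, ?_, ?_⟩
  · have hcast : ((D'.toNat : ℕ) : ℤ) = D' := Int.toNat_of_nonneg hD'pos.le
    apply Nat.ModEq.symm
    rw [Nat.modEq_iff_dvd, hcast, hD']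
    have : D + Q * (|D| + 1) - (a : ℤ) = (D - a) + (M : ℤ) * ((∏ ℓ ∈ S, (ℓ : ℤ)) * (|D| + 1)) := by rw [hQ]; ring
    rw [this]; exact dvd_add hDM (dvd_mul_right _ _)
  · intro ℓ hℓ r hr hdvd
    have hcast : ((D'.toNat : ℕ) : ℤ) = D' := Int.toNat_of_nonneg hD'pos.le
    rw [hcast, hD'] at hdvd
    have hℓQ : (ℓ : ℤ) ∣ Q := by rw [hQ]; exact Dvd.dvd.mul_left (Finset.dvd_prod_of_mem _ hℓ) _
    apply hD ℓ hℓ r hr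
    have e : D - r = (D + Q * (|D| + 1) - r) - Q * (|D| + 1) := by ring
    rw [e]; exact dvd_sub hdvd (Dvd.dvd.mul_right hℓQ _)

end Summit.BirchSwinnertonDyer.BirchSwinnertonDyer.Theorems.SignedMuAtTwo
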